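import Summits.RiemannHypothesis.RiemannHypothesis.Theorems.TwoPrimeFoldRigidity.Negative.MBTSolve

/-!
# One-lattice moment-blind towers, part 4: conditioning of the level solve

HONEST LABEL.  Negative-side helper toward `¬ IntegerScrew.TwoPrimeFoldRigidity` (item stmt-RiemannHypothesis-25784);
record-negative programme; 0 toward RH.  RH is not proved, not used, not mentioned below.
Nothing here bears on the truth of RH.

`SR + SI ≤ 25926 · nrm(τ)`: the raw coefficients of the solve are controlled by the weighted size
`|τ₀| + |τ₁|/(15Γ) + |τ₂|/(15Γ)²` of the target (the solve divides by `η ≍ Γ` once per moment order).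
-/

set_option linter.dupNamespace false

noncomputable section

open scoped ComplexConjugate
open Complex Finset

namespace Summit.RiemannHypothesis.RiemannHypothesis.Theorems.TwoPrimeFoldRigidity.Negative.MBT

namespace Prm

variable (p : Prm)

section Solve

variable (m : ℕ) (τ : ℕ → ℂ)

/-- the weighted size is nonnegative. -/
theorem nrm_nonneg (v : ℕ → ℂ) : 0 ≤ p.nrm m v := by
  have := p.Γ_pos m; unfold nrm; positivity

/-- each component is controlled by the weighted size. -/
theorem nrm_parts (v : ℕ → ℂ) : ‖v 0‖ ≤ p.nrm m v ∧ ‖v 1‖ ≤ 15 * p.Γ m * p.nrm m v ∧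
    ‖v 2‖ ≤ (15 * p.Γ m) ^ 2 * p.nrm m v := by
  have hΓ := p.Γ_pos m
  have hM : 0 < 15 * p.Γ m := by positivity
  unfold nrm
  refine ⟨?_, ?_, ?_⟩
  · have : 0 ≤ ‖v 1‖ / (15 * p.Γ m) := by positivity
    have : 0 ≤ ‖v 2‖ / (15 * p.Γ m) ^ 2 := by positivity
    linarith
  · rw [mul_add, mul_add, mul_div_cancel₀ _ hM.ne']
    have : 0 ≤ 15 * p.Γ m * ‖v 0‖ := by positivity
    have : 0 ≤ 15 * p.Γ m * (‖v 2‖ / (15 * p.Γ m) ^ 2) := by positivity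
    linarith
  · rw [mul_add, mul_add, mul_div_cancel₀ _ (pow_ne_zero 2 hM.ne')]
    have : 0 ≤ (15 * p.Γ m) ^ 2 * ‖v 0‖ := by positivity
    have : 0 ≤ (15 * p.Γ m) ^ 2 * (‖v 1‖ / (15 * p.Γ m)) := by positivity
    linarith

/-- **conditioning of the level solve**: the raw sizes are at most `25926 ×` the weighted size of the target. -/
theorem SR_add_SI_le : p.SR m τ + p.SI m τ ≤ 25926 * p.nrm m τ := by
  have hΓ := p.Γ_pos m; have hΓ1 := p.one_le_Γ m
  have hηΓ := p.Γ_le_η m; have hη2 := p.η_le m; have hη := p.η_pos m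
  set N := p.nrm m τ with hN
  have hN0 : 0 ≤ N := p.nrm_nonneg m τ
  obtain ⟨hτ0, hτ1, hτ2⟩ := p.nrm_parts m τ
  -- sizes of the base moments
  have hl : ‖p.W m (Sum.inl 0) 1‖ ≤ 15 * p.Γ m := by simpa using p.norm_W_le m (Sum.inl 0) 1
  have hl' : ‖p.W m (Sum.inr (Sum.inl 0)) 1‖ ≤ 15 * p.Γ m := by simpa using p.norm_W_le m (Sum.inr (Sum.inl 0)) 1
  have hm : ‖p.W m (Sum.inl 0) 2‖ ≤ (15 * p.Γ m) ^ 2 := p.norm_W_le m (Sum.inl 0) 2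
  have hm' : ‖p.W m (Sum.inr (Sum.inl 0)) 2‖ ≤ (15 * p.Γ m) ^ 2 := p.norm_W_le m (Sum.inr (Sum.inl 0)) 2
  -- a1, a4
  have ha1 : |a1 τ| ≤ N := le_trans (Complex.abs_re_le_norm _) hτ0
  have ha4 : |a4 τ| ≤ N := le_trans (Complex.abs_im_le_norm _) hτ0
  -- r1
  have hr1 : ‖p.r1 m τ‖ ≤ 45 * p.Γ m * N := by
    have e1 : ‖(a1 τ : ℂ) * p.W m (Sum.inl 0) 1‖ ≤ N * (15 * p.Γ m) := by
      rw [norm_mul, Complex.norm_real, Real.norm_eq_abs]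
      exact mul_le_mul ha1 hl (norm_nonneg _) hN0
    have e2 : ‖(a4 τ : ℂ) * I * p.W m (Sum.inr (Sum.inl 0)) 1‖ ≤ N * (15 * p.Γ m) := by
      rw [norm_mul, norm_mul, Complex.norm_I, mul_one, Complex.norm_real, Real.norm_eq_abs]
      exact mul_le_mul ha4 hl' (norm_nonneg _) hN0
    calc ‖p.r1 m τ‖ ≤ ‖τ 1 - (a1 τ : ℂ) * p.W m (Sum.inl 0) 1‖ + ‖(a4 τ : ℂ) * I * p.W m (Sum.inr (Sum.inl 0)) 1‖ :=
          norm_sub_le _ _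
      _ ≤ ‖τ 1‖ + ‖(a1 τ : ℂ) * p.W m (Sum.inl 0) 1‖ + ‖(a4 τ : ℂ) * I * p.W m (Sum.inr (Sum.inl 0)) 1‖ := by
          gcongr; exact norm_sub_le _ _
      _ ≤ 15 * p.Γ m * N + N * (15 * p.Γ m) + N * (15 * p.Γ m) := by gcongr
      _ = 45 * p.Γ m * N := by ring
  -- a2, a5
  have ha2 : |p.a2 m τ| ≤ 45 * N := by
    simp only [a2]; rw [abs_div, abs_of_pos hη, div_le_iff₀ hη]
    have := Complex.abs_im_le_norm (p.r1 m τ)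
    nlinarith
  have ha5 : |p.a5 m τ| ≤ 45 * N := by
    simp only [a5]; rw [abs_div, abs_of_pos hη, div_le_iff₀ hη, abs_neg]
    have := Complex.abs_re_le_norm (p.r1 m τ)
    nlinarith
  -- r2
  have hr2 : ‖p.r2 m τ‖ ≤ 6435 * p.Γ m ^ 2 * N := by
    have e1 : ‖(a1 τ : ℂ) * p.W m (Sum.inl 0) 2‖ ≤ N * (15 * p.Γ m) ^ 2 := by
      rw [norm_mul, Complex.norm_real, Real.norm_eq_abs]
      exact mul_le_mul ha1 hm (norm_nonneg _) hN0
    have e2 : ‖(a4 τ : ℂ) * I * p.W m (Sum.inr (Sum.inl 0)) 2‖ ≤ N * (15 * p.Γ m) ^ 2 := by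
      rw [norm_mul, norm_mul, Complex.norm_I, mul_one, Complex.norm_real, Real.norm_eq_abs]
      exact mul_le_mul ha4 hm' (norm_nonneg _) hN0
    have e3 : ‖(p.a2 m τ : ℂ) * (2 * I * (p.η m : ℂ) * p.W m (Sum.inl 0) 1 + (p.η m : ℂ) ^ 2)‖ ≤
        45 * N * (2 * p.η m * (15 * p.Γ m) + p.η m ^ 2) := by
      rw [norm_mul, Complex.norm_real, Real.norm_eq_abs]
      refine mul_le_mul ha2 ?_ (norm_nonneg _) (by positivity)
      calc ‖2 * I * (p.η m : ℂ) * p.W m (Sum.inl 0) 1 + (p.η m : ℂ) ^ 2‖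
          ≤ ‖2 * I * (p.η m : ℂ) * p.W m (Sum.inl 0) 1‖ + ‖(p.η m : ℂ) ^ 2‖ := norm_add_le _ _
        _ ≤ 2 * p.η m * (15 * p.Γ m) + p.η m ^ 2 := by
            rw [norm_mul, norm_mul, norm_mul, Complex.norm_I, norm_pow, Complex.norm_real,
              Real.norm_of_nonneg hη.le, Complex.norm_two, mul_one]
            gcongr
    have e4 : ‖(p.a5 m τ : ℂ) * (-2 * (p.η m : ℂ) * p.W m (Sum.inr (Sum.inl 0)) 1 + I * (p.η m : ℂ) ^ 2)‖ ≤
        45 * N * (2 * p.η m * (15 * p.Γ m) + p.η m ^ 2) := by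
      rw [norm_mul, Complex.norm_real, Real.norm_eq_abs]
      refine mul_le_mul ha5 ?_ (norm_nonneg _) (by positivity)
      calc ‖-2 * (p.η m : ℂ) * p.W m (Sum.inr (Sum.inl 0)) 1 + I * (p.η m : ℂ) ^ 2‖
          ≤ ‖-2 * (p.η m : ℂ) * p.W m (Sum.inr (Sum.inl 0)) 1‖ + ‖I * (p.η m : ℂ) ^ 2‖ := norm_add_le _ _
        _ ≤ 2 * p.η m * (15 * p.Γ m) + p.η m ^ 2 := by
            rw [norm_mul, norm_mul, norm_neg, norm_mul, Complex.norm_I, norm_pow, Complex.norm_real,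
              Real.norm_of_nonneg hη.le, Complex.norm_two, one_mul]
            gcongr
    have hsplit : ‖p.r2 m τ‖ ≤ ‖τ 2‖ + ‖(a1 τ : ℂ) * p.W m (Sum.inl 0) 2‖ +
        ‖(a4 τ : ℂ) * I * p.W m (Sum.inr (Sum.inl 0)) 2‖ +
        ‖(p.a2 m τ : ℂ) * (2 * I * (p.η m : ℂ) * p.W m (Sum.inl 0) 1 + (p.η m : ℂ) ^ 2)‖ +
        ‖(p.a5 m τ : ℂ) * (-2 * (p.η m : ℂ) * p.W m (Sum.inr (Sum.inl 0)) 1 + I * (p.η m : ℂ) ^ 2)‖ := by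
      unfold r2
      refine le_trans (norm_sub_le _ _) ?_
      gcongr
      refine le_trans (norm_sub_le _ _) ?_
      gcongr
      refine le_trans (norm_sub_le _ _) ?_
      gcongr
      exact norm_sub_le _ _
    have : ‖τ 2‖ + N * (15 * p.Γ m) ^ 2 + N * (15 * p.Γ m) ^ 2 + 45 * N * (2 * p.η m * (15 * p.Γ m) + p.η m ^ 2)
        + 45 * N * (2 * p.η m * (15 * p.Γ m) + p.η m ^ 2) ≤ 6435 * p.Γ m ^ 2 * N := by
      nlinarith [mul_nonneg hN0 (mul_nonneg hη.le hΓ.le), mul_nonneg hN0 (mul_nonneg hη.le hη.le)]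
    linarith
  -- a3, a6
  have h2η : 0 < 2 * p.η m ^ 2 := by positivity
  have ha3 : |p.a3 m τ| ≤ 3218 * N := by
    simp only [a3]
    rw [abs_div, show |-2 * p.η m ^ 2| = 2 * p.η m ^ 2 by
      rw [abs_of_neg (by linarith)]; ring, div_le_iff₀ h2η]
    have := Complex.abs_re_le_norm (p.r2 m τ)
    nlinarith [mul_le_mul_of_nonneg_left (pow_le_pow_left₀ hΓ.le hηΓ 2) hN0]
  have ha6 : |p.a6 m τ| ≤ 3218 * N := by
    simp only [a6]
    rw [abs_div, show |-2 * p.η m ^ 2| = 2 * p.η m ^ 2 by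
      rw [abs_of_neg (by linarith)]; ring, div_le_iff₀ h2η]
    have := Complex.abs_im_le_norm (p.r2 m τ)
    nlinarith [mul_le_mul_of_nonneg_left (pow_le_pow_left₀ hΓ.le hηΓ 2) hN0]
  -- assemble
  have hR := p.cR_vals m τ; have hI := p.cI_vals m τ
  simp only [SR, SI]
  rw [hR.1, hR.2.1, hR.2.2.1, hI.1, hI.2.1, hI.2.2.1]
  have t1 := abs_add_three (a1 τ) (p.a2 m τ) (p.a3 m τ)
  have t2 := abs_add_le (p.a2 m τ) (2 * p.a3 m τ)
  have t3 := abs_add_three (a4 τ) (p.a5 m τ) (p.a6 m τ)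
  have t4 := abs_add_le (p.a5 m τ) (2 * p.a6 m τ)
  rw [abs_mul, abs_two] at t2 t4
  linarith

end Solve

end Prm

end Summit.RiemannHypothesis.RiemannHypothesis.Theorems.TwoPrimeFoldRigidity.Negative.MBT
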